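import Literature.NumberTheory.Automorphic.TwistedQuotientLevelChangeNilpotent
import Literature.NumberTheory.Automorphic.TwistedQuotientIntegralFunctions
import HarnessLib

/-!
# The invariants `W^{L/L'}` of the level-`L'` function space are the induced-type module of level `L`

Topic `NumberTheory/Automorphic`; namespace `Literature.NumberTheory.Automorphic`, grouping
sub-namespace `TwistedQuotient`.  Definitions with bodies and theorems; no named fact.

For levels `L' ≤ L ≤ 𝒢` with `L'` normal in `L`, a representation `σ` of `L` on `N` which is
trivial on `L'` (`quotRep`: the induced representation of `L ⧸ L'`), and `Γ → 𝒢`: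

* `inducedLevelProd ι hle σ hσ`: the `Γ × (L ⧸ L')`-representation `W = Fun(𝒢 ⧸ L', N)` of
  `TwistedQuotientLevelChangeNilpotent` (`levelProdTwist` with `ρ = 1`: `Γ` by left translation,
  `L ⧸ L'` by `σ`-twisted right translation) — the object on whose invariants `W^{L/L'}`
  (`hKerRep _ 0`) the nilpotence theorems `pow_succ_map_φZ_levelProdTwist_eq_zero` /
  `TameLevel.pow_succ_map_φZ_heckePolyTower_eq_zero_of_heckeOperator` live;
* `descFun`, `toInvariants`, `ofInvariants`, **`indFunIsoInvariants : indFun ι L σ ≅ W^{L/L'}`**: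
  the induced-type `Γ`-representation `{F : 𝒢 → N | F(g l) = σ(l)⁻¹ F(g)}` of
  `TwistedQuotientIntegralFunctions` (the untwisted form of the integral functions `M̃`, there
  `intFunIso`) IS `W^{L/L'}`: `F ↦ (gL' ↦ F g)`;
* `val_φZ_toInvariants`: under this isomorphism an endomorphism `φ'` of `W` (e.g. the Hecke
  operator `heckeProdTwistHom g₀ = [L' g₀ L']`, `val_φZ_heckeProdTwistHom_toInvariants`) acts on
  the descended function.

With `N = M/p^m` and `σ` the reduction of `π|_L` on a stable lattice `M`, this identifies
`H^q(Γ, W^{L/L'})` with `H^q(X_K, ℳ_{ξ,K}/p^m)` computed through the cover `X_{K'} → X_K`, as in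
[Scholze2015, §V.4, proof of Thm. V.4.1].

## References

* P. Scholze, *On torsion in the cohomology of locally symmetric varieties*, Ann. of Math. 182
  (2015), §V.4, proof of Thm. V.4.1 [Scholze2015].
-/

noncomputable section

open CategoryTheory Literature.Algebra.Homology

universe u

namespace Literature.NumberTheory.Automorphic

namespace TwistedQuotient

variable {k : Type u} [CommRing k] {Γ 𝒢 : Type u} [Group Γ] [Group 𝒢] (ι : Γ →* 𝒢)
  {L' L : Subgroup 𝒢} (hle : L' ≤ L) [hN : (L'.subgroupOf L).Normal]
  {N : Type u} [AddCommGroup N] [Module k N] (σ : Representation k L N)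
  (hσ : ∀ l : L, (l : 𝒢) ∈ L' → σ l = 1)

/-- A representation of `L` trivial on `L'`, as a representation of `L ⧸ L'`. [folklore] -/
def quotRep : Representation k (L ⧸ L'.subgroupOf L) N :=
  QuotientGroup.lift (L'.subgroupOf L) σ fun l hl => hσ l (Subgroup.mem_subgroupOf.1 hl)

/-- `quotRep [l] = σ l`. [folklore] -/
@[simp]
theorem quotRep_mk (l : L) : quotRep σ hσ (l : L ⧸ L'.subgroupOf L) = σ l :=
  rfl

/-- The trivial `Γ`-action on the values commutes with `quotRep`. [folklore] -/
theorem commute_one_quotRep (γ : Γ) (h : L ⧸ L'.subgroupOf L) :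
    Commute ((1 : Representation k Γ N) γ) (quotRep σ hσ h) :=
  Commute.one_left _

/-- **`W = Fun(𝒢 ⧸ L', N)` as a representation of `Γ × (L ⧸ L')`**: `Γ` by left translation,
`L ⧸ L'` by `σ`-twisted right translation (`levelProdTwist` with `ρ = 1`).
[cite: Scholze2015, §V.4, proof of Thm. V.4.1] -/
abbrev inducedLevelProd : Rep k (Γ × (L ⧸ L'.subgroupOf L)) :=
  levelProdTwist ι hle (1 : Representation k Γ N) (quotRep σ hσ) (commute_one_quotRep σ hσ)

/-- `qsmul [l]⁻¹ (gL') = g l L'`. [folklore] -/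
theorem qsmul_inv_mk (l : L) (g : 𝒢) :
    qsmul hle (l : L ⧸ L'.subgroupOf L)⁻¹ (g : 𝒢 ⧸ L') = ((g * l : 𝒢) : 𝒢 ⧸ L') := by
  rw [← QuotientGroup.mk_inv, qsmul_mk, lsmul_mk, Subgroup.coe_inv, inv_inv]

/-- `σ(l) (σ(l⁻¹) v) = v`. [folklore] -/
theorem sigma_apply_inv_apply (l : L) (v : N) : σ l (σ l⁻¹ v) = v := by
  rw [← Module.End.mul_apply, ← map_mul, mul_inv_cancel, map_one, Module.End.one_apply]

/-- `σ(l⁻¹) (σ(l) v) = v`. [folklore] -/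
theorem sigma_inv_apply_apply (l : L) (v : N) : σ l⁻¹ (σ l v) = v := by
  rw [← Module.End.mul_apply, ← map_mul, inv_mul_cancel, map_one, Module.End.one_apply]

/-! ### From the induced module to the invariants -/

omit hN in
/-- A function `F : 𝒢 → N` with `F(g l) = σ(l)⁻¹ F(g)` is right `L'`-invariant (as `σ|_{L'} = 1`)
and descends to `𝒢 ⧸ L'`. [folklore] -/
def descFun (F : indFun ι L σ) : (𝒢 ⧸ L') → N := fun c =>
  Quotient.liftOn' c (fun g => F.1 g) fun g g' hgg' => by
    obtain ⟨l', rfl⟩ : ∃ l' : L', g' = g * l' :=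
      ⟨⟨g⁻¹ * g', QuotientGroup.leftRel_apply.1 hgg'⟩, by simp⟩
    have h := F.2 g ⟨(l' : 𝒢), hle l'.2⟩
    have h1 : σ (⟨(l' : 𝒢), hle l'.2⟩ : L)⁻¹ = 1 :=
      hσ _ (by rw [Subgroup.coe_inv]; exact L'.inv_mem l'.2)
    rw [h1, Module.End.one_apply] at h
    exact h.symm

omit hN in
/-- Unfolding lemma for `descFun`. [folklore] -/
@[simp]
theorem descFun_mk (F : indFun ι L σ) (g : 𝒢) : descFun ι hle σ hσ F (g : 𝒢 ⧸ L') = F.1 g :=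
  rfl

/-- The descended function is an `L ⧸ L'`-invariant `0`-cochain of `W`. [folklore] -/
def toInvariants (F : indFun ι L σ) : hKerRep (inducedLevelProd ι hle σ hσ) 0 :=
  ⟨fun _ => descFun ι hle σ hσ F,
    (mem_hKer_levelProdTwist_iff ι hle (1 : Representation k Γ N) (quotRep σ hσ)
      (commute_one_quotRep σ hσ) _).2 fun x h c => by
      induction h using QuotientGroup.induction_on with
      | H l =>
        induction c using QuotientGroup.induction_on with
        | H g => rw [quotRep_mk, qsmul_inv_mk, descFun_mk, descFun_mk, F.2 g l,
            sigma_apply_inv_apply]⟩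

/-- Unfolding lemma for `toInvariants`. [folklore] -/
@[simp]
theorem val_toInvariants (F : indFun ι L σ) (x : Fin 0 → L ⧸ L'.subgroupOf L) :
    (toInvariants ι hle σ hσ F).1 x = descFun ι hle σ hσ F :=
  rfl

/-- From an invariant `0`-cochain of `W` back to the induced module: `F(g) := f(gL')`. [folklore] -/
def ofInvariants (f : hKerRep (inducedLevelProd ι hle σ hσ) 0) : indFun ι L σ :=
  ⟨fun g => f.1 default (g : 𝒢 ⧸ L'), fun g l => by
    have key := (mem_hKer_levelProdTwist_iff ι hle (1 : Representation k Γ N) (quotRep σ hσ)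
      (commute_one_quotRep σ hσ) f.1).1 f.2 default (l : L ⧸ L'.subgroupOf L) (g : 𝒢 ⧸ L')
    rw [quotRep_mk, qsmul_inv_mk] at key
    change f.1 default ((g * l : 𝒢) : 𝒢 ⧸ L') = σ l⁻¹ (f.1 default (g : 𝒢 ⧸ L'))
    rw [← key, sigma_inv_apply_apply]⟩

/-- Unfolding lemma for `ofInvariants`. [folklore] -/
@[simp]
theorem val_ofInvariants_apply (f : hKerRep (inducedLevelProd ι hle σ hσ) 0) (g : 𝒢) :
    (ofInvariants ι hle σ hσ f).1 g = f.1 default (g : 𝒢 ⧸ L') :=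
  rfl

/-- The `Γ`-action on `W^{L/L'}` is, on values, the left translation. [folklore] -/
theorem val_ρ_inducedLevelProd_apply (γ : Γ) (f : hKerRep (inducedLevelProd ι hle σ hσ) 0)
    (x : Fin 0 → L ⧸ L'.subgroupOf L) (c : 𝒢 ⧸ L') :
    ((hKerRep (inducedLevelProd ι hle σ hσ) 0).ρ γ f).1 x c = f.1 x ((ι γ)⁻¹ • c) := by
  have h := Rep.hom_comm_apply (hι (inducedLevelProd ι hle σ hσ) 0) γ f
  rw [hι_hom_apply, hι_hom_apply] at h
  refine (congrFun (congrFun h x) c).trans ?_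
  change piConstRep (Fin 0 → L ⧸ L'.subgroupOf L) (resFst (inducedLevelProd ι hle σ hσ)).ρ γ
    f.1 x c = _
  rw [piConstRep_apply]
  change levelProdTwistRep ι hle (1 : Representation k Γ N) (quotRep σ hσ)
    (commute_one_quotRep σ hσ) (MonoidHom.inl _ _ γ) (f.1 x) c = _
  rw [levelProdTwistRep_inl, coeffRepresentation_apply, MonoidHom.one_apply,
    Module.End.one_apply]

/-- The `k`-linear identification `indFun ≃ W^{L/L'}`. [folklore] -/
def indFunEquivInvariants : indFun ι L σ ≃ₗ[k] hKerRep (inducedLevelProd ι hle σ hσ) 0 where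
  toFun := toInvariants ι hle σ hσ
  map_add' F F' := Subtype.ext (funext fun x => funext fun c => by
    induction c using QuotientGroup.induction_on with
    | H g => rfl)
  map_smul' a F := Subtype.ext (funext fun x => funext fun c => by
    induction c using QuotientGroup.induction_on with
    | H g => rfl)
  invFun := ofInvariants ι hle σ hσ
  left_inv F := Subtype.ext (funext fun g => rfl)
  right_inv f := Subtype.ext (funext fun x => funext fun c => by
    obtain rfl : x = default := Subsingleton.elim _ _
    induction c using QuotientGroup.induction_on with
    | H g => rfl)

/-- **`{F : 𝒢 → N | F(g l) = σ(l)⁻¹ F(g)} ≅ W^{L/L'}`** as `Γ`-representations: the induced-type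
module of level `L` (the untwisted integral functions, `intFunIso`) is the module of
`L ⧸ L'`-invariants of `W = Fun(𝒢 ⧸ L', N)`. [cite: Scholze2015, §V.4, proof of Thm. V.4.1] -/
def indFunIsoInvariants : indFun ι L σ ≅ hKerRep (inducedLevelProd ι hle σ hσ) 0 :=
  Rep.mkIso (Representation.Equiv.mk (indFunEquivInvariants ι hle σ hσ) fun γ =>
    LinearMap.ext fun F => Subtype.ext (funext fun x => funext fun c => by
      induction c using QuotientGroup.induction_on with
      | H g =>
        change descFun ι hle σ hσ ((indFunSubrep ι L σ).toRepresentation γ F) (g : 𝒢 ⧸ L') =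
          ((hKerRep (inducedLevelProd ι hle σ hσ) 0).ρ γ (toInvariants ι hle σ hσ F)).1 x
            (g : 𝒢 ⧸ L')
        rw [val_ρ_inducedLevelProd_apply, val_toInvariants, MulAction.Quotient.smul_coe,
          smul_eq_mul, descFun_mk, descFun_mk]
        rfl))

/-- Unfolding lemma for `indFunIsoInvariants`. [folklore] -/
@[simp]
theorem val_indFunIsoInvariants_hom_hom (F : indFun ι L σ) (x : Fin 0 → L ⧸ L'.subgroupOf L) :
    ((indFunIsoInvariants ι hle σ hσ).hom.hom F).1 x = descFun ι hle σ hσ F :=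
  rfl

/-- Unfolding lemma for `indFunIsoInvariants⁻¹`. [folklore] -/
@[simp]
theorem val_indFunIsoInvariants_inv_hom_apply (f : hKerRep (inducedLevelProd ι hle σ hσ) 0)
    (g : 𝒢) : ((indFunIsoInvariants ι hle σ hσ).inv.hom f).1 g = f.1 default (g : 𝒢 ⧸ L') :=
  rfl

/-! ### Endomorphisms of `W` on the induced module -/

/-- Under `indFunIsoInvariants`, `φZ _ φ' 0` acts by `φ'` on the descended function. [folklore] -/
theorem val_φZ_toInvariants (φ' : inducedLevelProd ι hle σ hσ ⟶ inducedLevelProd ι hle σ hσ)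
    (F : indFun ι L σ) (x : Fin 0 → L ⧸ L'.subgroupOf L) :
    ((φZ (inducedLevelProd ι hle σ hσ) φ' 0).hom (toInvariants ι hle σ hσ F)).1 x =
      φ'.hom (descFun ι hle σ hσ F) :=
  rfl

variable {g₀ : 𝒢} (hconj : ∀ l : L, ∃ a ∈ L', ∃ b ∈ L', (l : 𝒢) * g₀ * (l : 𝒢)⁻¹ = a * g₀ * b)
  (hfin' : (ArithmeticQuotient.doubleCosetQuot L' g₀).Finite)

/-- **The Hecke operator `[L' g₀ L']` of `W` acts on the induced module through the descended
function**: `(T F)‾ = T_{g₀} (F‾)` with `T_{g₀}` the double-coset operator of level `L'`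
(`ArithmeticQuotient.heckeFun`). [cite: Scholze2015, §V.4, proof of Thm. V.4.1] -/
theorem val_φZ_heckeProdTwistHom_toInvariants (F : indFun ι L σ) (x : Fin 0 → L ⧸ L'.subgroupOf L) :
    ((φZ (inducedLevelProd ι hle σ hσ)
        (heckeProdTwistHom ι hle (1 : Representation k Γ N) (quotRep σ hσ)
          (commute_one_quotRep σ hσ) hconj hfin') 0).hom (toInvariants ι hle σ hσ F)).1 x =
      ArithmeticQuotient.heckeFun k L' g₀ N (descFun ι hle σ hσ F) :=
  rfl

end TwistedQuotient

end Literature.NumberTheory.Automorphic
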